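import Literature.Probability.RandomPlanarGeometry.HexSAWBrickWallWalks
import HarnessLib

/-!
# A lower envelope for the bridges of the hexagonal lattice by length:
# `e^{-9√M} μ_ℍ^{2M} ≤ μ_ℍ · b_{2M}(ℍ)` (Hammersley–Welsh unfolding, twice)

Topic `Literature/Probability/RandomPlanarGeometry` (continues `HexSAWBrickWallWalks.lean`: the honeycomb
walks `HexBW.saws n ⊆ Zd.saws 2 n` in brick-wall coordinates, height = coordinate `0`, bridges
`HexBW.bridges n`, and the fact that the tree's `ℤ^d` unfolding `Zd.unfold` preserves them).

Sources: N. Madras, G. Slade, *The Self-Avoiding Walk* (1993), §3.1: Proposition 3.1.5 (the unfolding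
`h_N ≤ P_D(N) b_N`), Theorem 3.1.1 with (3.1.7)–(3.1.8), pp. 60–61 (`c_N` against bridges with an `e^{O(√N)}`
loss) and Corollary 3.1.6, (3.1.9), p. 61 (`μ^{N-1} e^{-B√N} ≤ b_N ≤ μ^N`, the length-indexed bridge envelope)
[cite: HammersleyWelsh1962]; H. Duminil-Copin, S. Smirnov,
Ann. of Math. 175 (2012), Theorem 1 (`μ_ℍ = √(2+√2)`; only `μ_ℍ^n ≤ c_n(ℍ)`, the tree's
`hexConnectiveConstant_pow_le`, is used here).

## The argument (a variant of the printed one avoiding the cut at the last minimum)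

Unfold an arbitrary `n`-step walk `ω` (`Zd.unfold`): the result ends at its maximal height, and at most
`e^{3√n}` walks have the same image (`Zd.card_le_exp_mul_card_image_unfold`).  Read the image backwards
from its endpoint and reflect the height (`rev`, injective): a walk that starts at its minimal height.
Unfold again: the result starts at its minimal and ends at its maximal height (a "weak bridge"), again at
most `e^{3√n}`-to-one.  Prepending one horizontal step (`prep`, injective) turns a weak bridge into a
bridge of length `n + 1`.  Hence **`c_n(ℍ) ≤ e^{6√n} b_{n+1}(ℍ)`**, and with `μ_ℍ^n ≤ c_n(ℍ)`,
**`e^{-9√M} μ_ℍ^{2M} ≤ μ_ℍ b_{2M}(ℍ)`** for `M ≥ 1` — the length-indexed lower envelope of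
Madras–Slade (3.1.9) on `ℍ`, in the shape consumed by the tree's rate engine
`Zd.KestenRateLower.lower_rate_cubeRoot_ins` (`hlo` with `c = 9`, `A = μ_ℍ`).  Where a walk is read from a
site of odd parity the parity twist `twistAt` of `HexSAWBrickWallWalks.lean` is applied (translations by odd
sites are not automorphisms of the brick wall).

## Contents (namespace `Literature.Probability.RandomPlanarGeometry.SAW.HexBW`, all PROVED)

* `twistWalk`, `rev`, `rev_mem`, `rev_injOn`, `prep`, `prep_mem_bridges`;
* **`hexSawCount_le_exp_mul_bridgeCount : c_n(ℍ) ≤ e^{6√n} · b_{n+1}(ℍ)`**;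
* **`exp_neg_mul_sqrt_mul_pow_le_bridgeCount : e^{-9√M} μ_ℍ^{2M} ≤ μ_ℍ · b_{2M}(ℍ)`** (`M ≥ 1`).
-/

noncomputable section

open Finset Function Literature.Probability.LatticeModels Literature.Probability.Percolation SimpleGraph

namespace Literature.Probability.RandomPlanarGeometry.SAW

namespace HexBW

/-! ### The parity twist applied to a walk -/

/-- Apply the parity twist at `p` to every vertex of a walk. [cite: MadrasSlade1993, §1.1] -/
def twistWalk (p : Site 2) (ω : ℕ → Site 2) : ℕ → Site 2 := fun i => twistAt p (ω i)

/-- Values of `twistWalk`. [cite: MadrasSlade1993, §1.1] -/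
@[simp] theorem twistWalk_apply (p : Site 2) (ω : ℕ → Site 2) (i : ℕ) :
    twistWalk p ω i = twistAt p (ω i) := rfl

/-- The twist does not change heights. [cite: MadrasSlade1993, §1.1] -/
theorem twistWalk_apply_zero (p : Site 2) (ω : ℕ → Site 2) (i : ℕ) : twistWalk p ω i 0 = ω i 0 :=
  twistAt_apply_zero p (ω i)

/-- `twistWalk p` is injective. [cite: MadrasSlade1993, §1.1] -/
theorem twistWalk_injective (p : Site 2) : Function.Injective (twistWalk p) := fun _ _ h =>
  funext fun i => twistAt_injective p (congrFun h i)

/-- The twist of a `ℤ²` self-avoiding walk is a `ℤ²` self-avoiding walk. [cite: MadrasSlade1993, §1.1] -/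
theorem twistWalk_mem_zd {n : ℕ} {ω : ℕ → Site 2} (hω : ω ∈ Zd.saws 2 n) (p : Site 2) :
    twistWalk p ω ∈ Zd.saws 2 n := by
  obtain ⟨h0, hend, hadj, hinj⟩ := Zd.mem_saws.1 hω
  refine Zd.mem_saws.2 ⟨by simp [h0], fun i hi => by simp [hend i hi], fun i hi =>
    (zd_adj_twistAt_iff p _ _).2 (hadj i hi), fun i hi j hj hij => hinj hi hj (twistAt_injective p hij)⟩

/-! ### Reading a walk backwards from its endpoint -/

/-- **Time reversal read at the origin, height reflected**: `rev n ω i = R₀ (twistAt (ω n) (ω (n-i) − ω n))`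
for `i ≤ n` (frozen after `n`), `R₀` the reflection `x ↦ −x` of the height.  A walk ending at its maximal
height becomes a walk starting at its minimal height. [cite: MadrasSlade1993, §3.1 (proof of Theorem 3.1.1)] -/
def rev (n : ℕ) (ω : ℕ → Site 2) : ℕ → Site 2 :=
  fun i => Zd.reflCoord 0 (twistAt (ω n) (ω (n - min i n) - ω n))

/-- Heights along `rev`. [cite: MadrasSlade1993, §3.1] -/
theorem rev_apply_zero (n : ℕ) (ω : ℕ → Site 2) (i : ℕ) :
    rev n ω i 0 = ω n 0 - ω (n - min i n) 0 := by
  rw [rev, Zd.reflCoord_apply_zero, twistAt_apply_zero, Pi.sub_apply]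
  ring

/-- `rev` maps honeycomb walks to honeycomb walks. [cite: MadrasSlade1993, §3.1 (proof of Theorem 3.1.1)] -/
theorem rev_mem {n : ℕ} {ω : ℕ → Site 2} (hω : ω ∈ saws n) : rev n ω ∈ saws n := by
  obtain ⟨h0, hend, hbw, hinj⟩ := mem_saws_iff.1 hω
  refine mem_saws_iff.2 ⟨?_, ?_, ?_, ?_⟩
  · have h : rev n ω 0 = Zd.reflCoord 0 0 := by
      simp only [rev, Nat.zero_min, Nat.sub_zero, sub_self, twistAt_zero]
    rw [h]
    exact (Zd.reflCoord_eq_self_iff 0 0).2 rfl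
  · intro i hi
    simp only [rev, min_eq_right hi, min_self]
  · intro i hi
    simp only [rev, min_eq_left hi.le, min_eq_left (by omega : i + 1 ≤ n)]
    refine adj_reflCoord 0 ((adj_twistAt_sub_iff (ω n) _ _).2 ?_)
    rw [show n - i = (n - (i + 1)) + 1 by omega]
    exact (hbw (n - (i + 1)) (by omega)).symm
  · intro i hi j hj hij
    simp only [Set.mem_setOf_eq] at hi hj
    simp only [rev, min_eq_left hi, min_eq_left hj] at hij
    have h1 := Zd.reflCoord_injective 0 hij
    have h2 := twistAt_injective (ω n) h1
    rw [sub_left_inj] at h2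
    have := hinj (show n - i ≤ n by omega) (show n - j ≤ n by omega) h2
    omega

/-- A walk ending at its maximal height is read backwards into a walk starting at its minimal height.
[cite: MadrasSlade1993, §3.1 (proof of Theorem 3.1.1)] -/
theorem rev_weakHalfSpace {n : ℕ} {ω : ℕ → Site 2} (hmax : ∀ i ≤ n, ω i 0 ≤ ω n 0) :
    ∀ i ≤ n, rev n ω 0 0 ≤ rev n ω i 0 := by
  intro i hi
  rw [rev_apply_zero, rev_apply_zero, Nat.zero_min, Nat.sub_zero, sub_self, min_eq_left hi, sub_nonneg]
  exact hmax (n - i) (by omega)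

/-- `rev n` is injective on honeycomb walks (the endpoint has parity `n`, which fixes the twist).
[cite: MadrasSlade1993, §3.1] -/
theorem rev_injOn (n : ℕ) : Set.InjOn (rev n) ↑(saws n) := by
  intro ω hω ω' hω' h
  rw [Finset.mem_coe] at hω hω'
  have hpar : (ω n 0 + ω n 1) % 2 = (ω' n 0 + ω' n 1) % 2 := by
    rw [parity_apply hω le_rfl, parity_apply hω' le_rfl]
  have key : ∀ i ≤ n, ω (n - i) - ω n = ω' (n - i) - ω' n := fun i hi => by
    have := congrFun h i
    simp only [rev, min_eq_left hi] at this
    have h1 := Zd.reflCoord_injective 0 this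
    rw [twistAt_congr hpar] at h1
    exact twistAt_injective _ h1
  obtain ⟨h0, hend, -, -⟩ := mem_saws_iff.1 hω
  obtain ⟨h0', hend', -, -⟩ := mem_saws_iff.1 hω'
  have hn : ω n = ω' n := by
    have := key n le_rfl
    rw [Nat.sub_self, h0, h0', zero_sub, zero_sub, neg_inj] at this
    exact this
  funext j
  rcases le_or_gt j n with hj | hj
  · have := key (n - j) (by omega)
    rw [show n - (n - j) = j by omega, hn, sub_left_inj] at this
    exact this
  · rw [hend j hj.le, hend' j hj.le, hn]

/-! ### Prepending a horizontal step -/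

/-- **Prepend one horizontal step**: `prep ω 0 = 0`, `prep ω (i+1) = negY (ω i) + e₀` (the old walk placed
at the odd site `e₀`, hence twisted). A weak bridge becomes a bridge. [cite: MadrasSlade1993, §3.1 (proof of Theorem 3.1.1, the extra step `−e₁`)] -/
def prep (ω : ℕ → Site 2) : ℕ → Site 2 :=
  fun i => if i = 0 then 0 else negY (ω (i - 1)) + Pi.single 0 1

/-- `prep ω 0 = 0`. [cite: MadrasSlade1993, §3.1] -/
@[simp] theorem prep_zero (ω : ℕ → Site 2) : prep ω 0 = 0 := by
  simp [prep]

/-- `prep ω (i+1) = negY (ω i) + e₀`. [cite: MadrasSlade1993, §3.1] -/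
theorem prep_succ (ω : ℕ → Site 2) (i : ℕ) : prep ω (i + 1) = negY (ω i) + Pi.single 0 1 := by
  simp [prep]

/-- Heights along `prep`: shifted by one. [cite: MadrasSlade1993, §3.1] -/
theorem prep_succ_apply_zero (ω : ℕ → Site 2) (i : ℕ) : prep ω (i + 1) 0 = ω i 0 + 1 := by
  rw [prep_succ, Pi.add_apply, negY_apply_zero, Pi.single_eq_same]

/-- `prep` is injective. [cite: MadrasSlade1993, §3.1] -/
theorem prep_injective : Function.Injective prep := fun ω ω' h => funext fun i => by
  have := congrFun h (i + 1)
  rw [prep_succ, prep_succ, add_left_inj] at this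
  exact negY_injective this

/-- `negY` is the twist at the odd site `e₀`. [cite: MadrasSlade1993, §1.1] -/
theorem negY_eq_twistAt_single (z : Site 2) : negY z = twistAt (Pi.single 0 1) z := by
  unfold twistAt
  simp

/-- **A weak bridge with a horizontal step prepended is a bridge.** [cite: MadrasSlade1993, §3.1 (proof of Theorem 3.1.1)] -/
theorem prep_mem_bridges {n : ℕ} {ω : ℕ → Site 2} (hω : ω ∈ saws n) (hlo : ∀ i ≤ n, ω 0 0 ≤ ω i 0)
    (hhi : ∀ i ≤ n, ω i 0 ≤ ω n 0) : prep ω ∈ bridges (n + 1) := by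
  obtain ⟨h0, hend, hbw, hinj⟩ := mem_saws_iff.1 hω
  have h00 : ω 0 0 = 0 := by rw [h0]; rfl
  have hz : (0 : Site 2) 0 = 0 := rfl
  have hpos : ∀ i, 1 ≤ i → i ≤ n + 1 → 1 ≤ prep ω i 0 := fun i h1 h2 => by
    obtain ⟨k, rfl⟩ : ∃ k, i = k + 1 := ⟨i - 1, by omega⟩
    rw [prep_succ_apply_zero]
    have := hlo k (by omega)
    rw [h00] at this
    linarith
  refine mem_bridges.2 ⟨mem_saws_iff.2 ⟨prep_zero ω, ?_, ?_, ?_⟩, ?_⟩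
  · intro i hi
    obtain ⟨k, rfl⟩ : ∃ k, i = k + 1 := ⟨i - 1, by omega⟩
    rw [prep_succ, prep_succ, hend k (by omega)]
  · intro i hi
    rcases Nat.eq_zero_or_pos i with rfl | hipos
    · rw [prep_zero, zero_add, prep_succ, h0, negY_zero]
      exact adj_add_single 0
    · obtain ⟨k, rfl⟩ : ∃ k, i = k + 1 := ⟨i - 1, by omega⟩
      rw [prep_succ, prep_succ, negY_eq_twistAt_single, negY_eq_twistAt_single]
      exact (adj_twistAt_add_iff _ _ _).2 (hbw k (by omega))
  · intro i hi j hj hij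
    simp only [Set.mem_setOf_eq] at hi hj
    rcases Nat.eq_zero_or_pos i with rfl | hipos <;> rcases Nat.eq_zero_or_pos j with rfl | hjpos
    · rfl
    · exfalso
      have h1 := hpos j hjpos hj
      rw [← hij, prep_zero, hz] at h1
      exact absurd h1 (by norm_num)
    · exfalso
      have h1 := hpos i hipos hi
      rw [hij, prep_zero, hz] at h1
      exact absurd h1 (by norm_num)
    · obtain ⟨k, rfl⟩ : ∃ k, i = k + 1 := ⟨i - 1, by omega⟩
      obtain ⟨l, rfl⟩ : ∃ l, j = l + 1 := ⟨j - 1, by omega⟩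
      rw [prep_succ, prep_succ, add_left_inj] at hij
      have := hinj (show k ≤ n by omega) (show l ≤ n by omega) (negY_injective hij)
      omega
  · intro i h1 h2
    rw [prep_zero, hz]
    obtain ⟨k, rfl⟩ : ∃ k, i = k + 1 := ⟨i - 1, by omega⟩
    rw [prep_succ_apply_zero, prep_succ_apply_zero]
    have ha := hlo k (by omega)
    have hb := hhi k (by omega)
    rw [h00] at ha
    exact ⟨by linarith, by linarith⟩

/-! ### `c_n(ℍ) ≤ e^{6√n} b_{n+1}(ℍ)` -/

/-- **`c_n(ℍ) ≤ e^{6√n} · b_{n+1}(ℍ)`**: unfold (at most `e^{3√n}`-to-one), read backwards from the endpoint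
(injective), unfold again (at most `e^{3√n}`-to-one), prepend a horizontal step (injective): the image is a
bridge of length `n + 1`. [cite: MadrasSlade1993, Proposition 3.1.5 and Corollary 3.1.6, (3.1.9), p. 61 (via (3.1.7)–(3.1.8), pp. 60–61)] -/
theorem hexSawCount_le_exp_mul_bridgeCount (n : ℕ) :
    (hexSawCount n : ℝ) ≤ Real.exp (6 * Real.sqrt n) * bridgeCount (n + 1) := by
  classical
  set T₀ : Finset (ℕ → Site 2) := saws n with hT₀
  set T₁ : Finset (ℕ → Site 2) := T₀.image (Zd.unfold n) with hT₁
  set T₂ : Finset (ℕ → Site 2) := T₁.image (rev n) with hT₂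
  set T₃ : Finset (ℕ → Site 2) := T₂.image (Zd.unfold n) with hT₃
  have hT₀sub : T₀ ⊆ Zd.saws 2 n := saws_subset n
  have hT₁mem : ∀ ξ ∈ T₁, ξ ∈ saws n ∧ ∀ i ≤ n, ξ i 0 ≤ ξ n 0 := by
    intro ξ hξ
    obtain ⟨ω, hω, rfl⟩ := Finset.mem_image.1 hξ
    exact ⟨unfold_mem hω, fun i hi => Zd.apply_le_unfold_last (hT₀sub hω) hi⟩
  have hT₂mem : ∀ ξ ∈ T₂, ξ ∈ saws n ∧ ∀ i ≤ n, ξ 0 0 ≤ ξ i 0 := by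
    intro ξ hξ
    obtain ⟨ω, hω, rfl⟩ := Finset.mem_image.1 hξ
    obtain ⟨h1, h2⟩ := hT₁mem ω hω
    exact ⟨rev_mem h1, rev_weakHalfSpace h2⟩
  have hT₂sub : T₂ ⊆ Zd.saws 2 n := fun ξ hξ => saws_subset n (hT₂mem ξ hξ).1
  have hT₃mem : ∀ ξ ∈ T₃, ξ ∈ saws n ∧ (∀ i ≤ n, ξ 0 0 ≤ ξ i 0) ∧ ∀ i ≤ n, ξ i 0 ≤ ξ n 0 := by
    intro ξ hξ
    obtain ⟨ω, hω, rfl⟩ := Finset.mem_image.1 hξ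
    obtain ⟨h1, h2⟩ := hT₂mem ω hω
    exact ⟨unfold_mem h1, Zd.weakHalfSpace_iterate_unfoldStep h2 (n + 1),
      fun i hi => Zd.apply_le_unfold_last (saws_subset n h1) hi⟩
  have h01 : ((#T₀ : ℕ) : ℝ) ≤ Real.exp (3 * Real.sqrt n) * #T₁ :=
    Zd.card_le_exp_mul_card_image_unfold hT₀sub
  have h12 : #T₂ = #T₁ :=
    Finset.card_image_of_injOn fun ω hω ω' hω' h => rev_injOn n (hT₁mem ω hω).1 (hT₁mem ω' hω').1 h
  have h23 : ((#T₂ : ℕ) : ℝ) ≤ Real.exp (3 * Real.sqrt n) * #T₃ :=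
    Zd.card_le_exp_mul_card_image_unfold hT₂sub
  have h34 : #T₃ ≤ bridgeCount (n + 1) := by
    rw [bridgeCount, ← Finset.card_image_of_injective T₃ prep_injective]
    refine Finset.card_le_card fun ξ hξ => ?_
    obtain ⟨ω, hω, rfl⟩ := Finset.mem_image.1 hξ
    obtain ⟨h1, h2, h3⟩ := hT₃mem ω hω
    exact prep_mem_bridges h1 h2 h3
  have h34' : ((#T₃ : ℕ) : ℝ) ≤ bridgeCount (n + 1) := by exact_mod_cast h34
  have hexp : Real.exp (3 * Real.sqrt n) * Real.exp (3 * Real.sqrt n) = Real.exp (6 * Real.sqrt n) := by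
    rw [← Real.exp_add]
    ring_nf
  have he : 0 ≤ Real.exp (3 * Real.sqrt n) := Real.exp_nonneg _
  calc (hexSawCount n : ℝ) = ((#T₀ : ℕ) : ℝ) := by rw [hT₀, card_saws]
    _ ≤ Real.exp (3 * Real.sqrt n) * #T₁ := h01
    _ = Real.exp (3 * Real.sqrt n) * #T₂ := by rw [h12]
    _ ≤ Real.exp (3 * Real.sqrt n) * (Real.exp (3 * Real.sqrt n) * #T₃) :=
        mul_le_mul_of_nonneg_left h23 he
    _ ≤ Real.exp (3 * Real.sqrt n) * (Real.exp (3 * Real.sqrt n) * bridgeCount (n + 1)) :=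
        mul_le_mul_of_nonneg_left (mul_le_mul_of_nonneg_left h34' he) he
    _ = Real.exp (6 * Real.sqrt n) * bridgeCount (n + 1) := by rw [← mul_assoc, hexp]

/-! ### The lower envelope for even lengths -/

/-- **`e^{-9√M} μ_ℍ^{2M} ≤ μ_ℍ · b_{2M}(ℍ)` for `M ≥ 1`** — Madras–Slade (3.1.9) on the honeycomb lattice,
by length, from `c_{2M-1}(ℍ) ≤ e^{6√(2M-1)} b_{2M}(ℍ)` and `μ_ℍ^{2M-1} ≤ c_{2M-1}(ℍ)`; the shape `hlo` of the
tree's rate engine `Zd.KestenRateLower.lower_rate_cubeRoot_ins` (`c = 9`, `A = μ_ℍ`).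
[cite: MadrasSlade1993, Corollary 3.1.6, eq. (3.1.9), p. 61] -/
theorem exp_neg_mul_sqrt_mul_pow_le_bridgeCount (M : ℕ) (hM : 1 ≤ M) :
    Real.exp (-(9 * Real.sqrt M)) * hexConnectiveConstant ^ (2 * M) ≤
      hexConnectiveConstant * bridgeCount (2 * M) := by
  have hμ : 0 < hexConnectiveConstant := hexConnectiveConstant_pos
  obtain ⟨n, hn⟩ : ∃ n, 2 * M = n + 1 := ⟨2 * M - 1, by omega⟩
  have h1 := hexSawCount_le_exp_mul_bridgeCount n
  have h2 := hexConnectiveConstant_pow_le n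
  rw [← hn] at h1
  have hsqrt : 6 * Real.sqrt n ≤ 9 * Real.sqrt M := by
    have hnM : (n : ℝ) ≤ 2 * M := by exact_mod_cast (by omega : n ≤ 2 * M)
    have hs : Real.sqrt n ≤ Real.sqrt 2 * Real.sqrt M := by
      rw [← Real.sqrt_mul (by norm_num)]
      exact Real.sqrt_le_sqrt hnM
    have h2le : Real.sqrt 2 ≤ 3 / 2 := by
      rw [show (3 / 2 : ℝ) = Real.sqrt ((3 / 2) ^ 2) by rw [Real.sqrt_sq (by norm_num)]]
      exact Real.sqrt_le_sqrt (by norm_num)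
    have hM0 : 0 ≤ Real.sqrt M := Real.sqrt_nonneg _
    nlinarith
  have hb : (0 : ℝ) ≤ bridgeCount (2 * M) := Nat.cast_nonneg _
  calc Real.exp (-(9 * Real.sqrt M)) * hexConnectiveConstant ^ (2 * M)
      = Real.exp (-(9 * Real.sqrt M)) * (hexConnectiveConstant * hexConnectiveConstant ^ n) := by
        rw [hn, pow_succ']
    _ ≤ Real.exp (-(6 * Real.sqrt n)) * (hexConnectiveConstant * hexSawCount n) :=
        mul_le_mul (Real.exp_le_exp.2 (by linarith)) (mul_le_mul_of_nonneg_left h2 hμ.le)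
          (by positivity) (by positivity)
    _ ≤ Real.exp (-(6 * Real.sqrt n)) *
          (hexConnectiveConstant * (Real.exp (6 * Real.sqrt n) * bridgeCount (2 * M))) :=
        mul_le_mul_of_nonneg_left (mul_le_mul_of_nonneg_left h1 hμ.le) (Real.exp_nonneg _)
    _ = hexConnectiveConstant * bridgeCount (2 * M) := by
        rw [Real.exp_neg]
        field_simp

end HexBW

end Literature.Probability.RandomPlanarGeometry.SAW
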